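import Mathlib.LinearAlgebra.Matrix.Determinant.Basic
import Mathlib.LinearAlgebra.Matrix.NonsingularInverse
import Mathlib.LinearAlgebra.Matrix.Block
import Mathlib.Data.Fintype.EquivFin
import Summits.CriticalPhenomena.PercolationContinuityZ3.Theorems.SahiMasterFamilyFCombShiftBasic
import HarnessLib

/-!
# THEOREM S: the inclusion matrix between a down-shifted family and the family is unimodular

Support file (cell `prim-bnk`, seat bnk-2 gen 21; `--supports stmt-CriticalPhenomena-4575`; complete write-up
`run/shared/lean/prim/prim-l12/PROOF-F-inequality.md`).  No definition, no `sorry`, standard axioms.  Part of the proof of the comb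
inequality `K(A,B,G) ≥ 0` for ALL monotone third events `G`, hence of the master-family inequality
`(1+μG)μ(A∩B∩G) ≥ μG·μ(A∩B) + μ(A∩G)μ(B∩G)` for all increasing `A,B,G` and every product measure (`…FCombAllThirdEvents`).

**THEOREM S (`shift_det`).**  For every family `G` of points of the cube `Fin n → Bool` and every list `s` of distinct coordinates, the
inclusion matrix `([e i ≤ j])_{i,j ∈ G}` — rows the down-shifted family `dnSeq s G` read through any bijection `e : G ≃ dnSeq s G`, columns
`G` — has determinant `±1` over `ℤ`.  Proof by induction on `s`: for `s = c :: rest`, after the column operation `col(K+c) −= col(K)`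
(`K` in both `c`-sections) the matrix is block-triangular with diagonal blocks of the same kind for the union and the intersection of the
two `c`-sections of `G` and the shorter list; the base case is the unitriangular `ζ[G,G]` (block-triangular for the weight grading).
The inclusion graph can have several perfect matchings (permanents up to `13` at `n = 3`), so the `±1` is a genuine cancellation.
[this work; presumably folklore in the down-shift literature (Frankl, Alon, Frankl–Pach)]
NOTE: the parallel file `…FCombShiftDet` (lead seat prim-nh-lead-4575, landed while this chain was being split) proves the same
theorem for `Finset (Finset α)` with Mathlib's `Down.compression`; this file is the `Fin n → Bool` / `SahiFComb.dnSeq` version that the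
rest of this chain (`…DisjointMatching`, `…AllThirdEvents`) is written against.
-/

namespace Summit.CriticalPhenomena.PercolationContinuityZ3.Theorems

namespace SahiFComb

open Finset

variable {n : ℕ}

/-! ### 4. The zeta kernel -/

/-- The zeta kernel is `1` on comparable pairs. [folklore] -/
theorem zeta_of_le {x y : Fin n → Bool} (h : ∀ i, x i = true → y i = true) : zeta x y = 1 := by
  unfold zeta; rw [if_pos h]

/-- The zeta kernel is `0` on incomparable pairs. [folklore] -/
theorem zeta_of_not_le {x y : Fin n → Bool} (h : ¬ ∀ i, x i = true → y i = true) : zeta x y = 0 := by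
  unfold zeta; rw [if_neg h]

/-- Weight is monotone. -/
theorem wt_le_of_le {x y : Fin n → Bool} (h : ∀ i, x i = true → y i = true) : wt x ≤ wt y := by
  unfold wt
  exact Finset.card_le_card (fun i hi => by
    rw [Finset.mem_filter] at hi ⊢; exact ⟨hi.1, h i hi.2⟩)

/-- Comparable points of equal weight are equal. -/
theorem eq_of_le_of_wt_eq {x y : Fin n → Bool} (h : ∀ i, x i = true → y i = true) (hw : wt x = wt y) : x = y := by
  have hsub : Finset.univ.filter (fun i => x i = true) ⊆ Finset.univ.filter (fun i => y i = true) := by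
    intro i hi; rw [Finset.mem_filter] at hi ⊢; exact ⟨hi.1, h i hi.2⟩
  have heq := Finset.eq_of_subset_of_card_le hsub (by unfold wt at hw; rw [hw])
  funext i
  have := congrArg (fun S => i ∈ S) heq
  simp only [Finset.mem_filter, Finset.mem_univ, true_and, eq_iff_iff] at this
  cases hx : x i <;> cases hy : y i <;> simp_all

/-- Zeta kernel of inserted tuples, lower row level: `ζ((F,0),(K,t)) = ζ(F,K)`. [folklore] -/
theorem zeta_insertNth_false (c : Fin (n + 1)) (t : Bool) (F K : Fin n → Bool) :
    zeta (Fin.insertNth (α := fun _ => Bool) c false F) (Fin.insertNth (α := fun _ => Bool) c t K) = zeta F K := by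
  unfold zeta
  congr 1
  apply propext
  constructor
  · intro h i hi
    have := h (c.succAbove i)
    rw [insertNth_apply_succAbove', insertNth_apply_succAbove'] at this
    exact this hi
  · intro h k
    refine Fin.succAboveCases c ?_ (fun j => ?_) k
    · rw [insertNth_apply_same']; simp
    · rw [insertNth_apply_succAbove', insertNth_apply_succAbove']; exact h j

/-- Zeta kernel of inserted tuples, upper row level: `ζ((F,1),(K,t)) = [t = 1] ζ(F,K)`. [folklore] -/
theorem zeta_insertNth_true (c : Fin (n + 1)) (t : Bool) (F K : Fin n → Bool) :
    zeta (Fin.insertNth (α := fun _ => Bool) c true F) (Fin.insertNth (α := fun _ => Bool) c t K) =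
      if t = true then zeta F K else 0 := by
  cases t
  · rw [if_neg (by simp)]
    apply zeta_of_not_le
    intro h
    have := h c
    rw [insertNth_apply_same', insertNth_apply_same'] at this
    simp at this
  · rw [if_pos rfl]
    unfold zeta
    congr 1
    apply propext
    constructor
    · intro h i hi
      have := h (c.succAbove i)
      rw [insertNth_apply_succAbove', insertNth_apply_succAbove'] at this
      exact this hi
    · intro h k
      refine Fin.succAboveCases c ?_ (fun j => ?_) k
      · rw [insertNth_apply_same', insertNth_apply_same']; simp
      · rw [insertNth_apply_succAbove', insertNth_apply_succAbove']; exact h j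

/-! ### 5. Determinant tools -/

open Matrix in
/-- Reindexing rows and columns by (possibly different) equivalences preserves invertibility of the determinant. -/
theorem isUnit_det_submatrix_equiv {l m : Type} [Fintype l] [Fintype m] [DecidableEq l] [DecidableEq m]
    (M : Matrix m m ℤ) (σ τ : l ≃ m) : IsUnit (M.submatrix σ τ).det ↔ IsUnit M.det := by
  have h2 : M.submatrix (⇑σ) (⇑τ) = (M.submatrix σ σ).submatrix id ((τ.trans σ.symm : l ≃ l)) := by
    ext i j; simp
  rw [h2, Matrix.det_permute', Matrix.det_submatrix_equiv_self]
  constructor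
  · intro hu
    exact isUnit_of_mul_isUnit_right hu
  · intro hu
    exact IsUnit.mul (by
      rcases Int.units_eq_one_or (Equiv.Perm.sign (τ.trans σ.symm)) with h1 | h1 <;> simp [h1]) hu

open Matrix in
/-- `1 - N` has invertible determinant when `N * N = 0`. -/
theorem isUnit_det_one_sub_of_sq_zero {m : Type} [Fintype m] [DecidableEq m] (N : Matrix m m ℤ) (hN : N * N = 0) :
    IsUnit (1 - N).det := by
  apply Matrix.isUnit_det_of_right_inverse (B := 1 + N)
  rw [Matrix.sub_mul, Matrix.one_mul, Matrix.mul_add, Matrix.mul_one, hN]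
  abel

open Matrix in
/-- The inclusion matrix of a family on itself has determinant `1` (it is unitriangular for the weight grading). -/
theorem det_zeta_self (G : Finset (Fin n → Bool)) :
    (Matrix.of fun (i j : ↥G) => zeta (i : Fin n → Bool) (j : Fin n → Bool)).det = 1 := by
  set M : Matrix ↥G ↥G ℤ := Matrix.of fun (i j : ↥G) => zeta (i : Fin n → Bool) (j : Fin n → Bool) with hM
  have hbt : M.BlockTriangular (fun i : ↥G => wt (i : Fin n → Bool)) := by
    intro i j hij
    rw [hM, Matrix.of_apply]
    apply zeta_of_not_le
    intro hle
    exact absurd (wt_le_of_le hle) (not_le.mpr hij)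
  rw [hbt.det]
  refine Finset.prod_eq_one (fun k _ => ?_)
  have hblock : M.toSquareBlock (fun i : ↥G => wt (i : Fin n → Bool)) k = 1 := by
    ext a b
    rw [Matrix.toSquareBlock_def]
    simp only [hM, Matrix.of_apply]
    by_cases hab : a = b
    · subst hab
      rw [Matrix.one_apply_eq]
      exact zeta_of_le (fun i hi => hi)
    · rw [Matrix.one_apply_ne hab]
      apply zeta_of_not_le
      intro hle
      apply hab
      have hw : wt ((a : ↥G) : Fin n → Bool) = wt ((b : ↥G) : Fin n → Bool) := by rw [a.2, b.2]
      exact Subtype.ext (Subtype.ext (eq_of_le_of_wt_eq hle hw))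
  rw [hblock, Matrix.det_one]


/-! ### 6. THEOREM S: the inclusion matrix between a down-shifted family and the family is unimodular -/

open Matrix

/-- One step of THEOREM S: if the statement holds for the shorter sequence on both `c`-aggregates of `G`
(union and intersection of the two `c`-sections), it holds for `c :: rest` on `G`. -/
theorem shift_det_step (c : Fin (n + 1)) (rest : List (Fin n)) (G : Finset (Fin (n + 1) → Bool))
    (ih0 : ∀ e0 : ↥(sec c false G ∪ sec c true G) ≃ ↥(dnSeq rest (sec c false G ∪ sec c true G)),
      IsUnit (Matrix.of fun (i j : ↥(sec c false G ∪ sec c true G)) =>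
        zeta ((e0 i : ↥(dnSeq rest (sec c false G ∪ sec c true G))) : Fin n → Bool) (j : Fin n → Bool)).det)
    (ih1 : ∀ e1 : ↥(sec c false G ∩ sec c true G) ≃ ↥(dnSeq rest (sec c false G ∩ sec c true G)),
      IsUnit (Matrix.of fun (i j : ↥(sec c false G ∩ sec c true G)) =>
        zeta ((e1 i : ↥(dnSeq rest (sec c false G ∩ sec c true G))) : Fin n → Bool) (j : Fin n → Bool)).det)
    (e : ↥G ≃ ↥(dnSeq (c :: rest.map c.succAbove) G)) :
    IsUnit (Matrix.of fun (i j : ↥G) =>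
      zeta ((e i : ↥(dnSeq (c :: rest.map c.succAbove) G)) : Fin (n + 1) → Bool) (j : Fin (n + 1) → Bool)).det := by
  -- notation
  set U : Finset (Fin n → Bool) := sec c false G ∪ sec c true G with hU
  set V : Finset (Fin n → Bool) := sec c false G ∩ sec c true G with hV
  have hsec0 : sec c false (dnSeq (c :: rest.map c.succAbove) G) = dnSeq rest U := by
    rw [dnSeq_cons, sec_dnSeq_map, sec_false_dn_self]
  have hsec1 : sec c true (dnSeq (c :: rest.map c.succAbove) G) = dnSeq rest V := by
    rw [dnSeq_cons, sec_dnSeq_map, sec_true_dn_self]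
  have hcardU : Fintype.card ↥U = Fintype.card ↥(dnSeq rest U) := by simp [card_dnSeq]
  have hcardV : Fintype.card ↥V = Fintype.card ↥(dnSeq rest V) := by simp [card_dnSeq]
  obtain ⟨e0⟩ : Nonempty (↥U ≃ ↥(dnSeq rest U)) := ⟨Fintype.equivOfCardEq hcardU⟩
  obtain ⟨e1⟩ : Nonempty (↥V ≃ ↥(dnSeq rest V)) := ⟨Fintype.equivOfCardEq hcardV⟩
  have hA := ih0 e0
  have hDm := ih1 e1
  have hVsub : ∀ v : Fin n → Bool, v ∈ V → v ∈ sec c false G := fun v hv => (Finset.mem_inter.mp hv).1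
  have hVsub' : ∀ v : Fin n → Bool, v ∈ V → v ∈ sec c true G := fun v hv => (Finset.mem_inter.mp hv).2
  have hVU : ∀ v : Fin n → Bool, v ∈ V → v ∈ U := fun v hv => Finset.mem_union.mpr (Or.inl (hVsub v hv))
  have hUnot : ∀ u : Fin n → Bool, u ∈ U → u ∉ sec c false G → u ∈ sec c true G := fun u hu hn =>
    (Finset.mem_union.mp hu).resolve_left hn
  -- the column equivalence Φ : U ⊕ V ≃ G
  let Φf : ↥U ⊕ ↥V → ↥G := fun p => match p with
    | Sum.inl u => if h : (u : Fin n → Bool) ∈ sec c false G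
        then ⟨Fin.insertNth c false (u : Fin n → Bool), mem_sec.mp h⟩
        else ⟨Fin.insertNth c true (u : Fin n → Bool), mem_sec.mp (hUnot u u.2 h)⟩
    | Sum.inr v => ⟨Fin.insertNth c true (v : Fin n → Bool), mem_sec.mp (hVsub' v v.2)⟩
  have hΦinl : ∀ u : ↥U, ∃ t : Bool, ((Φf (Sum.inl u) : ↥G) : Fin (n + 1) → Bool) = Fin.insertNth c t (u : Fin n → Bool) := by
    intro u
    by_cases h : (u : Fin n → Bool) ∈ sec c false G
    · exact ⟨false, by simp [Φf, h]⟩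
    · exact ⟨true, by simp [Φf, h]⟩
  have hΦinlV : ∀ v : ↥V, ((Φf (Sum.inl ⟨v, hVU v v.2⟩) : ↥G) : Fin (n + 1) → Bool) =
      Fin.insertNth c false (v : Fin n → Bool) := by
    intro v
    simp [Φf, hVsub v v.2]
  have hΦinr : ∀ v : ↥V, ((Φf (Sum.inr v) : ↥G) : Fin (n + 1) → Bool) = Fin.insertNth c true (v : Fin n → Bool) :=
    fun v => rfl
  have hΦinj : Function.Injective Φf := by
    rintro (u | v) (u' | v') h
    · have h' := congrArg (fun z : ↥G => (z : Fin (n + 1) → Bool)) h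
      obtain ⟨t, ht⟩ := hΦinl u
      obtain ⟨t', ht'⟩ := hΦinl u'
      simp only [ht, ht'] at h'
      have := Fin.insertNth_inj.mp h'
      exact congrArg Sum.inl (Subtype.ext (by exact this.2))
    · exfalso
      have h' := congrArg (fun z : ↥G => (z : Fin (n + 1) → Bool)) h
      simp only [hΦinr] at h'
      by_cases hu : (u : Fin n → Bool) ∈ sec c false G
      · simp only [Φf, hu, dif_pos] at h'
        have := (Fin.insertNth_inj.mp h').1
        simp at this
      · simp only [Φf, hu, dif_neg, not_false_eq_true] at h'
        have := (Fin.insertNth_inj.mp h').2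
        apply hu
        rw [this]
        exact hVsub v' v'.2
    · exfalso
      have h' := congrArg (fun z : ↥G => (z : Fin (n + 1) → Bool)) h
      simp only [hΦinr] at h'
      by_cases hu : (u' : Fin n → Bool) ∈ sec c false G
      · simp only [Φf, hu, dif_pos] at h'
        have := (Fin.insertNth_inj.mp h').1
        simp at this
      · simp only [Φf, hu, dif_neg, not_false_eq_true] at h'
        have := (Fin.insertNth_inj.mp h').2
        apply hu
        rw [← this]
        exact hVsub v v.2
    · have h' := congrArg (fun z : ↥G => (z : Fin (n + 1) → Bool)) h
      simp only [hΦinr] at h'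
      exact congrArg Sum.inr (Subtype.ext (Fin.insertNth_inj.mp h').2)
  have hcardG : Fintype.card (↥U ⊕ ↥V) = Fintype.card ↥G := by
    rw [Fintype.card_sum, Fintype.card_coe, Fintype.card_coe, Fintype.card_coe, hU, hV,
      Finset.card_union_add_card_inter, card_sec_add]
  have hΦbij : Function.Bijective Φf := (Fintype.bijective_iff_injective_and_card Φf).mpr ⟨hΦinj, hcardG⟩
  let Φ : ↥U ⊕ ↥V ≃ ↥G := Equiv.ofBijective Φf hΦbij
  -- the row equivalence Ψ : U ⊕ V ≃ D
  let Ψf : ↥U ⊕ ↥V → ↥(dnSeq (c :: rest.map c.succAbove) G) := fun p => match p with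
    | Sum.inl u => ⟨Fin.insertNth c false ((e0 u : ↥(dnSeq rest U)) : Fin n → Bool),
        mem_sec.mp (by rw [hsec0]; exact (e0 u).2)⟩
    | Sum.inr v => ⟨Fin.insertNth c true ((e1 v : ↥(dnSeq rest V)) : Fin n → Bool),
        mem_sec.mp (by rw [hsec1]; exact (e1 v).2)⟩
  have hΨinj : Function.Injective Ψf := by
    rintro (u | v) (u' | v') h <;> have h' := congrArg (fun z : ↥(dnSeq (c :: rest.map c.succAbove) G) => (z : Fin (n + 1) → Bool)) h <;>
      simp only [Ψf] at h' <;> have h2 := Fin.insertNth_inj.mp h'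
    · exact congrArg Sum.inl (e0.injective (Subtype.ext h2.2))
    · simp at h2
    · simp at h2
    · exact congrArg Sum.inr (e1.injective (Subtype.ext h2.2))
  have hcardD : Fintype.card (↥U ⊕ ↥V) = Fintype.card ↥(dnSeq (c :: rest.map c.succAbove) G) := by
    rw [hcardG, Fintype.card_coe, Fintype.card_coe, card_dnSeq]
  let Ψ : ↥U ⊕ ↥V ≃ ↥(dnSeq (c :: rest.map c.succAbove) G) := Equiv.ofBijective Ψf ((Fintype.bijective_iff_injective_and_card Ψf).mpr ⟨hΨinj, hcardD⟩)
  -- the reindexed matrix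
  set M : Matrix ↥G ↥G ℤ := Matrix.of fun (i j : ↥G) =>
      zeta ((e i : ↥(dnSeq (c :: rest.map c.succAbove) G)) : Fin (n + 1) → Bool) (j : Fin (n + 1) → Bool) with hM
  set M₁ : Matrix (↥U ⊕ ↥V) (↥U ⊕ ↥V) ℤ := Matrix.of fun p q =>
      zeta ((Ψ p : ↥(dnSeq (c :: rest.map c.succAbove) G)) : Fin (n + 1) → Bool) ((Φ q : ↥G) : Fin (n + 1) → Bool) with hM₁
  have hsub : M₁ = M.submatrix (Ψ.trans e.symm) Φ := by
    ext p q
    simp [hM₁, hM, Matrix.submatrix_apply]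
  have hiff : IsUnit M₁.det ↔ IsUnit M.det := by
    rw [hsub]; exact isUnit_det_submatrix_equiv M _ _
  rw [← hiff]
  -- the column operation
  let N : Matrix (↥U ⊕ ↥V) (↥U ⊕ ↥V) ℤ := Matrix.of fun p q => match p, q with
    | Sum.inl u, Sum.inr v => if (u : Fin n → Bool) = (v : Fin n → Bool) then 1 else 0
    | _, _ => 0
  have hNN : N * N = 0 := by
    ext p q
    rw [Matrix.mul_apply, Matrix.zero_apply]
    refine Finset.sum_eq_zero (fun r _ => ?_)
    rcases r with u | v
    · rcases p with u' | v' <;> simp [N]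
    · rcases q with u' | v' <;> simp [N]
  have hunitN : IsUnit (1 - N).det := isUnit_det_one_sub_of_sq_zero N hNN
  have hmulN : ∀ p : ↥U ⊕ ↥V, ∀ v : ↥V, (M₁ * N) p (Sum.inr v) = M₁ p (Sum.inl ⟨v, hVU v v.2⟩) := by
    intro p v
    rw [Matrix.mul_apply, Fintype.sum_sum_type]
    have h2 : ∑ v' : ↥V, M₁ p (Sum.inr v') * N (Sum.inr v') (Sum.inr v) = 0 :=
      Finset.sum_eq_zero (fun v' _ => by simp [N])
    rw [h2, add_zero]
    rw [Finset.sum_eq_single ⟨(v : Fin n → Bool), hVU v v.2⟩]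
    · simp [N]
    · intro u _ hu
      have : (u : Fin n → Bool) ≠ (v : Fin n → Bool) := fun h => hu (Subtype.ext h)
      simp [N, this]
    · intro h; exact absurd (Finset.mem_univ _) h
  have hmulN' : ∀ p : ↥U ⊕ ↥V, ∀ u : ↥U, (M₁ * N) p (Sum.inl u) = 0 := by
    intro p u
    rw [Matrix.mul_apply]
    refine Finset.sum_eq_zero (fun r _ => ?_)
    rcases r with u' | v' <;> simp [N]
  -- the blocks
  set A : Matrix ↥U ↥U ℤ := Matrix.of fun (i j : ↥U) =>
      zeta ((e0 i : ↥(dnSeq rest U)) : Fin n → Bool) (j : Fin n → Bool) with hAdef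
  set Dm : Matrix ↥V ↥V ℤ := Matrix.of fun (i j : ↥V) =>
      zeta ((e1 i : ↥(dnSeq rest V)) : Fin n → Bool) (j : Fin n → Bool) with hDmdef
  set C : Matrix ↥V ↥U ℤ := Matrix.of fun v u => (M₁ * (1 - N)) (Sum.inr v) (Sum.inl u) with hCdef
  have hblock : M₁ * (1 - N) = Matrix.fromBlocks A 0 C Dm := by
    ext p q
    rw [Matrix.mul_sub, Matrix.mul_one, Matrix.sub_apply]
    rcases p with u | v <;> rcases q with u' | v'
    · rw [hmulN', sub_zero, Matrix.fromBlocks_apply₁₁, hM₁, Matrix.of_apply, hAdef, Matrix.of_apply]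
      obtain ⟨t, ht⟩ := hΦinl u'
      show zeta ((Ψf (Sum.inl u) : ↥(dnSeq (c :: rest.map c.succAbove) G)) : Fin (n + 1) → Bool) ((Φf (Sum.inl u') : ↥G) : Fin (n + 1) → Bool) = _
      rw [ht]
      exact zeta_insertNth_false c t _ _
    · rw [hmulN, Matrix.fromBlocks_apply₁₂, Matrix.zero_apply, hM₁, Matrix.of_apply, Matrix.of_apply]
      show zeta ((Ψf (Sum.inl u) : ↥(dnSeq (c :: rest.map c.succAbove) G)) : Fin (n + 1) → Bool) ((Φf (Sum.inr v') : ↥G) : Fin (n + 1) → Bool) -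
        zeta ((Ψf (Sum.inl u) : ↥(dnSeq (c :: rest.map c.succAbove) G)) : Fin (n + 1) → Bool) ((Φf (Sum.inl ⟨v', hVU v' v'.2⟩) : ↥G) : Fin (n + 1) → Bool) = 0
      rw [hΦinr, hΦinlV]
      show zeta (Fin.insertNth c false _) _ - zeta (Fin.insertNth c false _) _ = 0
      rw [zeta_insertNth_false, zeta_insertNth_false, sub_self]
    · rw [Matrix.fromBlocks_apply₂₁, hCdef, Matrix.of_apply, Matrix.mul_sub, Matrix.mul_one, Matrix.sub_apply]
    · rw [hmulN, Matrix.fromBlocks_apply₂₂, hM₁, Matrix.of_apply, Matrix.of_apply, hDmdef, Matrix.of_apply]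
      show zeta ((Ψf (Sum.inr v) : ↥(dnSeq (c :: rest.map c.succAbove) G)) : Fin (n + 1) → Bool) ((Φf (Sum.inr v') : ↥G) : Fin (n + 1) → Bool) -
        zeta ((Ψf (Sum.inr v) : ↥(dnSeq (c :: rest.map c.succAbove) G)) : Fin (n + 1) → Bool) ((Φf (Sum.inl ⟨v', hVU v' v'.2⟩) : ↥G) : Fin (n + 1) → Bool) = _
      rw [hΦinr, hΦinlV]
      show zeta (Fin.insertNth c true _) _ - zeta (Fin.insertNth c true _) _ = _
      rw [zeta_insertNth_true, zeta_insertNth_true]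
      simp
  have hdetB : IsUnit (M₁ * (1 - N)).det := by
    rw [hblock, Matrix.det_fromBlocks_zero₁₂]
    exact IsUnit.mul hA hDm
  rw [Matrix.det_mul] at hdetB
  exact isUnit_of_mul_isUnit_left hdetB


/-- Lists avoiding `c` are images of lists under `c.succAbove`. -/
theorem exists_map_succAbove (c : Fin (n + 1)) : ∀ (l : List (Fin (n + 1))), c ∉ l →
    ∃ l' : List (Fin n), l'.map c.succAbove = l := by
  intro l
  induction l with
  | nil => intro _; exact ⟨[], rfl⟩
  | cons i l ih =>
    intro h
    have hi : i ≠ c := fun hic => h (by rw [hic]; exact List.mem_cons_self)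
    have hl : c ∉ l := fun hc => h (List.mem_cons_of_mem _ hc)
    obtain ⟨l', hl'⟩ := ih hl
    obtain ⟨j, hj⟩ := Fin.exists_succAbove_eq hi
    exact ⟨j :: l', by rw [List.map_cons, hj, hl']⟩

/-- **THEOREM S (shift determinant).**  For every family `G` of points of the cube and every list `s` of distinct
coordinates, the inclusion matrix between the down-shifted family `dnSeq s G` (rows, through any bijection `e`) and `G`
(columns) has determinant `±1`. [this work; presumably folklore in the down-shift literature] -/
theorem shift_det_aux : ∀ (k n : ℕ) (G : Finset (Fin n → Bool)) (s : List (Fin n)), s.Nodup → s.length = k →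
    ∀ e : ↥G ≃ ↥(dnSeq s G), IsUnit (Matrix.of fun (i j : ↥G) =>
      zeta ((e i : ↥(dnSeq s G)) : Fin n → Bool) (j : Fin n → Bool)).det := by
  intro k
  induction k with
  | zero =>
    intro n G s hs hl e
    have hs0 : s = [] := List.eq_nil_of_length_eq_zero hl
    subst hs0
    exact (isUnit_det_submatrix_equiv (Matrix.of fun (i j : ↥G) => zeta (i : Fin n → Bool) (j : Fin n → Bool))
      e (Equiv.refl _)).mpr (by rw [det_zeta_self]; exact isUnit_one)
  | succ k ih =>
    intro n G s hs hl e
    match n, s with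
    | _, [] => simp at hl
    | 0, (c :: rest) => exact c.elim0
    | (n' + 1), (c :: rest) =>
      have hc : c ∉ rest := (List.nodup_cons.mp hs).1
      have hrest : rest.Nodup := (List.nodup_cons.mp hs).2
      obtain ⟨rest', hmap⟩ := exists_map_succAbove c rest hc
      subst hmap
      have hnd : rest'.Nodup := List.Nodup.of_map _ hrest
      have hlen : rest'.length = k := by simpa using hl
      exact shift_det_step c rest' G (fun e0 => ih n' _ rest' hnd hlen e0) (fun e1 => ih n' _ rest' hnd hlen e1) e

/-- **THEOREM S**, packaged: `det ζ[dnSeq s G, G]` is a unit of `ℤ` for every family `G` and every list `s` of distinct coordinates. [this work] -/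
theorem shift_det (G : Finset (Fin n → Bool)) (s : List (Fin n)) (hs : s.Nodup) (e : ↥G ≃ ↥(dnSeq s G)) :
    IsUnit (Matrix.of fun (i j : ↥G) => zeta ((e i : ↥(dnSeq s G)) : Fin n → Bool) (j : Fin n → Bool)).det :=
  shift_det_aux s.length n G s hs rfl e


end SahiFComb

end Summit.CriticalPhenomena.PercolationContinuityZ3.Theorems
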